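import Mathlib
import Summits.ValiantsHypothesis.ValiantsHypothesis.Theses.ValuativeGCT
import Summits.ValiantsHypothesis.ValiantsHypothesis.Theorems.ValuativeGCTValuativeFlipIsotypicBinomialCount
import Summits.ValiantsHypothesis.ValiantsHypothesis.Theorems.ValuativeGCTValuativeFlipIsotypicSliceBound

/-!
# Isotypic slice bound, binomial form, part 2: the det census `C(λ₂+m, m) · ∏ C(λ_i+m²-1, m²-1)`

Det side of crux `ValuativeGCT.ValuativeFlip` (stmt-ValiantsHypothesis-12624; wall-breaker axis
"det-orbit-closure multiplicity bounds for detCensus").  Part 1 (`…IsotypicBinomialCount`,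
`isoc_core`) counts the Krylov-slice monomials of a prescribed row weight EXACTLY, slot by slot.
This file states the resulting ISOTYPIC det census in the crux's currencies, sharpening every
statement of the landed `…IsotypicSliceBound` (box count `(λ₂+1)^(m+1) · ∏_{i≥3} (λ_i+1)^(m²)`):

* `sandHwsp_finrank_le_of_weight_choose` — for `m ≥ 2`, any weight `χ`, any two row slots
  `j₀ ≠ j₁`: `dim (Hom_D ⊓ SAND ⊓ HWSP(χ)) ≤ C(d j₁ + m, m) · ∏_{j ∉ {j₀,j₁}} C(d j + m² - 1, m² - 1)`,
  `d = (-χ)⁺`;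
* `isotypicBinomialBound` — for `χ = λ*`:
  `dim (Hom_D ⊓ SAND ⊓ HWSP(λ*)) ≤ C(λ₂ + m, m) · ∏_{i ≥ 3} C(λ_i + m² - 1, m² - 1)`;
* `isotypicBinomialBound_le_isotypicSliceBound` — it is at most the box count
  (`C(k + n, n) ≤ (k+1)^n`, `choose_add_le_succ_pow`);
* `isotypic_truncT_finrank_le_choose`, `isotypic_detOrbitMultiplicity_le_choose`,
  `isotypic_detOrbitMultiplicity_le_fourRow_choose` — the same for every valuative truncation
  `T_U(λ)` of the crux (verbatim `let T`) and for `K_m(λ*) = mult_{λ*} ℂ[Δ(det_m)]`;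
* `valuativeFlip_of_binomialCertificates`, `detOrbitMultiplicity_lt_of_binomialCertificate` —
  the crux from per-side certificates beating the binomial census, and the Mulmuley–Sohoni
  obstruction at one position.

Reading for the crux.  The det capacity of a shape is governed by its parts from the second on;
in the binomial form a part `λ_i` (`i ≥ 3`) of bounded size costs a POLYNOMIAL factor
`C(λ_i + m² - 1, m² - 1) ≤ (m²)^(λ_i)` in `m` (box form: `(λ_i+1)^(m²) ≥ 2^(m²)`), and the second
part costs `C(λ₂ + m, m) ≤ min((λ₂+1)^m, (m+1)^(λ₂))`.  So for shapes of growing length with a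
light tail `w = λ₃ + λ₄ + ⋯` the threshold a per-side certificate family has to beat in the tail
(`stub_tailFlip`) drops from `2^(m²·(ℓ(λ)-2))` to `C(λ₂+m, m) · m^(2w)`.  Elementary over part 1,
`stub_stabInv_le_explicit` and `ValuativeBound_proof`; no named facts.
-/

set_option linter.dupNamespace false

namespace Summit.ValiantsHypothesis.ValiantsHypothesis.Theorems.ValuativeFlip

open MvPolynomial
open scoped BigOperators Matrix
open Literature.NumberTheory.DiophantineGeometry
open Literature.Computability.AlgebraicComplexity

noncomputable section

/-! ## The binomial bound for a general weight -/

/-- **Isotypic slice bound, binomial form, general weight** (`N = t + 2`, any two distinct row slots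
`j₀ ≠ j₁`).  The degree-`D` polynomials on `End W` (`W = ℂ^{N×N}`, variables `X (j, i)`) invariant
under the row-wise unimodular sandwich and `B`-semi-invariant of weight `χ` span a space of
dimension at most `C(d j₁ + N, N) · ∏_{j ∉ {j₀, j₁}} C(d j + N² - 1, N² - 1)`, `d := (-χ)⁺` —
independent of `D` and of the weight at the scalar slot `j₀`.
[folklore: Krylov normal form + torus weights + stars and bars] -/
theorem isoc_finrank_le_of_weight (t : ℕ) {j₀ j₁ : MatIdx (t + 2)} (h01 : j₀ ≠ j₁)
    (χ : Weight (MatIdx (t + 2))) (D : ℕ) :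
    Module.finrank ℂ ↥(homogeneousSubmodule (MatIdx (t + 2) × MatIdx (t + 2)) ℂ D ⊓
        (⨅ (P : Matrix (Fin (t + 2)) (Fin (t + 2)) ℂ) (Q : Matrix (Fin (t + 2)) (Fin (t + 2)) ℂ)
          (_ : P.det = 1) (_ : Q.det = 1),
          LinearMap.ker ((aeval (sbSubst P Q)).toLinearMap - LinearMap.id)) ⊓
        (⨅ (g : Matrix.GeneralLinearGroup (MatIdx (t + 2)) ℂ) (_ : IsUpperTriangular g),
          LinearMap.ker ((MvPolynomial.aeval (R := ℂ) fun p : MatIdx (t + 2) × MatIdx (t + 2) =>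
              ∑ l : MatIdx (t + 2), ((g⁻¹ : Matrix.GeneralLinearGroup (MatIdx (t + 2)) ℂ) :
                Matrix (MatIdx (t + 2)) (MatIdx (t + 2)) ℂ) p.1 l •
                  (MvPolynomial.X (l, p.2) : MvPolynomial (MatIdx (t + 2) × MatIdx (t + 2)) ℂ)).toLinearMap -
            weightChar χ g • (LinearMap.id : MvPolynomial (MatIdx (t + 2) × MatIdx (t + 2)) ℂ →ₗ[ℂ]
              MvPolynomial (MatIdx (t + 2) × MatIdx (t + 2)) ℂ)))) ≤
      ((-χ j₁).toNat + (t + 2)).choose (t + 2) *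
        ∏ j ∈ Finset.univ.filter (fun j : MatIdx (t + 2) => ¬(j = j₀ ∨ j = j₁)),
          ((-χ j).toNat + ((t + 2) * (t + 2) - 1)).choose ((t + 2) * (t + 2) - 1) := by
  classical
  have hfilter : (Finset.univ.filter fun j : MatIdx (t + 2) =>
      j ∈ (Set.univ : Set (MatIdx (t + 2))) ∧ ¬(j = j₀ ∨ j = j₁)) =
      Finset.univ.filter fun j : MatIdx (t + 2) => ¬(j = j₀ ∨ j = j₁) := by
    ext j
    simp
  refine (isoc_core t Set.univ j₀ j₁ h01 (Set.mem_univ j₀) (Set.mem_univ j₁) χ D _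
    (inf_le_left.trans inf_le_left) (fun G hG P Q hP hQ => ?_) (fun G _ => ?_)
    (fun G hG g hg => ?_)).trans (le_of_eq ?_)
  · have h2 := (Submodule.mem_inf.mp (Submodule.mem_inf.mp hG).1).2
    simp only [Submodule.mem_iInf, LinearMap.mem_ker, LinearMap.sub_apply, sub_eq_zero] at h2
    exact h2 P Q hP hQ
  · rw [mem_supported]
    intro p _
    exact Set.mem_univ _
  · have h2 := (Submodule.mem_inf.mp hG).2
    simp only [Submodule.mem_iInf, LinearMap.mem_ker, LinearMap.sub_apply, sub_eq_zero] at h2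
    exact h2 g hg
  · rw [hfilter]

/-- **Isotypic slice bound, binomial form, general weight, in the crux's conventions** (`m ≥ 2`, any
two distinct row slots `j₀ ≠ j₁ : MatIdx m`).  The degree-`D` row-wise unimodular sandwich
invariants on `End(ℂ^{m×m})` (the crux's explicit stabiliser clause) that are `B`-semi-invariant of
weight `χ` (the crux's Borel clause, verbatim) span a space of dimension at most
`C(d j₁ + m, m) · ∏_{j ∉ {j₀, j₁}} C(d j + m² - 1, m² - 1)`, `d := (-χ)⁺`.
Sharpens `sandHwsp_finrank_le_of_weight`. [folklore: Krylov normal form + stars and bars] -/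
theorem sandHwsp_finrank_le_of_weight_choose (m : ℕ) (hm : 2 ≤ m) (j₀ j₁ : MatIdx m) (h01 : j₀ ≠ j₁)
    (χ : Weight (MatIdx m)) (D : ℕ) :
    Module.finrank ℂ ↥(MvPolynomial.homogeneousSubmodule (MatIdx m × MatIdx m) ℂ D ⊓
        (⨅ (P : Matrix (Fin m) (Fin m) ℂ) (Q : Matrix (Fin m) (Fin m) ℂ) (_ : P.det = 1) (_ : Q.det = 1),
          LinearMap.ker ((MvPolynomial.aeval fun p : MatIdx m × MatIdx m =>
            ∑ l : MatIdx m, (P (ofLex p.2).1 (ofLex l).1 * Q (ofLex l).2 (ofLex p.2).2) •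
              (MvPolynomial.X (p.1, l) : MvPolynomial (MatIdx m × MatIdx m) ℂ)).toLinearMap -
            (LinearMap.id : MvPolynomial (MatIdx m × MatIdx m) ℂ →ₗ[ℂ] MvPolynomial (MatIdx m × MatIdx m) ℂ))) ⊓
        (⨅ (g : Matrix.GeneralLinearGroup (MatIdx m) ℂ) (_ : IsUpperTriangular g),
          LinearMap.ker ((MvPolynomial.aeval fun p : MatIdx m × MatIdx m =>
            ∑ l : MatIdx m, ((g⁻¹ : Matrix.GeneralLinearGroup (MatIdx m) ℂ) : Matrix (MatIdx m) (MatIdx m) ℂ) p.1 l •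
              (MvPolynomial.X (l, p.2) : MvPolynomial (MatIdx m × MatIdx m) ℂ)).toLinearMap -
            weightChar χ g • (LinearMap.id : MvPolynomial (MatIdx m × MatIdx m) ℂ →ₗ[ℂ]
              MvPolynomial (MatIdx m × MatIdx m) ℂ)))) ≤
      ((-χ j₁).toNat + m).choose m *
        ∏ j ∈ Finset.univ.filter (fun j : MatIdx m => ¬(j = j₀ ∨ j = j₁)),
          ((-χ j).toNat + (m * m - 1)).choose (m * m - 1) := by
  obtain ⟨t, rfl⟩ : ∃ t, m = t + 2 := ⟨m - 2, by omega⟩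
  exact isoc_finrank_le_of_weight t h01 χ D

/-! ## Partition weights: the bound in terms of the parts `λ₂, λ₃, …` -/

/-- **ISOTYPIC BINOMIAL BOUND** (det side of crux `ValuativeGCT.ValuativeFlip`, closed form in the
shape).  For `m ≥ 2`, every degree `D` and every partition `λ` (parts `λ₁ ≥ λ₂ ≥ …`, any number of
them), the degree-`D` row-wise unimodular sandwich invariants on `End(ℂ^{m×m})` that are
`B`-semi-invariant of weight `λ* = (dualOfPartition (m·m) λ).toMatIdx` — the det-side multiplicity
space `Hom_D ⊓ SAND ⊓ HWSP(λ*)` of the crux, which contains every valuative truncation `T_U(λ)` —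
span a space of dimension at most
`C(λ₂ + m, m) · ∏_{i ≥ 3} C(λ_i + m² - 1, m² - 1)`  (`0`-indexed sorted parts
`λ_{i+1} = sortedParts.getD i 0` over `2 ≤ i < m²`): the EXACT number of monomials of row degrees
`(λ₁, λ₂, λ₃, …)` on the Krylov slice (slot of `λ₁` a scalar — one monomial; slot of `λ₂` a companion
matrix — `m + 1` coordinates; every further slot free — `m²` coordinates).  No dependence on `λ₁`
or `D`.  Sharpens `isotypicSliceBound` (`(λ₂+1)^(m+1) · ∏ (λ_i+1)^(m²)`,
`isotypicBinomialBound_le_isotypicSliceBound`). [folklore: Krylov normal form + torus weights +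
stars and bars; this crux's det census] -/
theorem isotypicBinomialBound (m : ℕ) (hm : 2 ≤ m) (D : ℕ) {d : ℕ} (lam : Nat.Partition d) :
    Module.finrank ℂ ↥(MvPolynomial.homogeneousSubmodule (MatIdx m × MatIdx m) ℂ D ⊓
        (⨅ (P : Matrix (Fin m) (Fin m) ℂ) (Q : Matrix (Fin m) (Fin m) ℂ) (_ : P.det = 1) (_ : Q.det = 1),
          LinearMap.ker ((MvPolynomial.aeval fun p : MatIdx m × MatIdx m =>
            ∑ l : MatIdx m, (P (ofLex p.2).1 (ofLex l).1 * Q (ofLex l).2 (ofLex p.2).2) •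
              (MvPolynomial.X (p.1, l) : MvPolynomial (MatIdx m × MatIdx m) ℂ)).toLinearMap -
            (LinearMap.id : MvPolynomial (MatIdx m × MatIdx m) ℂ →ₗ[ℂ] MvPolynomial (MatIdx m × MatIdx m) ℂ))) ⊓
        (⨅ (g : Matrix.GeneralLinearGroup (MatIdx m) ℂ) (_ : IsUpperTriangular g),
          LinearMap.ker ((MvPolynomial.aeval fun p : MatIdx m × MatIdx m =>
            ∑ l : MatIdx m, ((g⁻¹ : Matrix.GeneralLinearGroup (MatIdx m) ℂ) : Matrix (MatIdx m) (MatIdx m) ℂ) p.1 l •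
              (MvPolynomial.X (l, p.2) : MvPolynomial (MatIdx m × MatIdx m) ℂ)).toLinearMap -
            weightChar ((Weight.dualOfPartition (m * m) lam).toMatIdx : Weight (MatIdx m)) g •
              (LinearMap.id : MvPolynomial (MatIdx m × MatIdx m) ℂ →ₗ[ℂ] MvPolynomial (MatIdx m × MatIdx m) ℂ)))) ≤
      (lam.sortedParts.getD 1 0 + m).choose m *
        ∏ i ∈ Finset.Ico 2 (m * m), (lam.sortedParts.getD i 0 + (m * m - 1)).choose (m * m - 1) := by
  have hmm : 4 ≤ m * m := by nlinarith
  set e := matIdxEquiv m with he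
  set a : Fin (m * m) := ⟨m * m - 1, by omega⟩ with ha
  set b : Fin (m * m) := ⟨m * m - 2, by omega⟩ with hb
  have hab : a ≠ b := fun h => by
    have := congrArg Fin.val h
    simp only [ha, hb] at this
    omega
  have h01 : e a ≠ e b := fun h => hab (e.injective h)
  set χ := ((Weight.dualOfPartition (m * m) lam).toMatIdx : Weight (MatIdx m)) with hχ
  have hval : ∀ i : Fin (m * m), (-χ (e i)).toNat = lam.sortedParts.getD (m * m - 1 - i) 0 :=
    fun i => neg_toMatIdx_dualOfPartition_toNat m lam i
  refine (sandHwsp_finrank_le_of_weight_choose m hm (e a) (e b) h01 χ D).trans (le_of_eq ?_)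
  have hidx : m * m - 1 - ((b : Fin (m * m)) : ℕ) = 1 := by
    simp only [hb, Fin.val_mk]
    omega
  congr 1
  · rw [hval b, hidx]
  · -- reindex the product over the slots `j ∉ {e a, e b}` by the part index `i = m² - 1 - idx j`
    set G : ℕ → ℕ := fun i => (lam.sortedParts.getD i 0 + (m * m - 1)).choose (m * m - 1) with hG
    set F : ℕ → ℕ := fun i => if 2 ≤ i then G i else 1 with hF
    have h1 : ∏ j ∈ Finset.univ.filter (fun j : MatIdx m => ¬(j = e a ∨ j = e b)),
        ((-χ j).toNat + (m * m - 1)).choose (m * m - 1) =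
        ∏ j : MatIdx m, (if ¬(j = e a ∨ j = e b) then
          ((-χ j).toNat + (m * m - 1)).choose (m * m - 1) else 1) := by
      rw [Finset.prod_filter]
    have h2 : ∏ j : MatIdx m, (if ¬(j = e a ∨ j = e b) then
          ((-χ j).toNat + (m * m - 1)).choose (m * m - 1) else 1) =
        ∏ i : Fin (m * m), F (m * m - 1 - (i : ℕ)) := by
      refine (Fintype.prod_equiv e.toEquiv (fun i : Fin (m * m) => F (m * m - 1 - (i : ℕ)))
        (fun j => if ¬(j = e a ∨ j = e b) then
          ((-χ j).toNat + (m * m - 1)).choose (m * m - 1) else 1) fun i => ?_).symm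
      have hi : (i = a ∨ i = b) ↔ (e i = e a ∨ e i = e b) := by
        rw [e.injective.eq_iff, e.injective.eq_iff]
      show F (m * m - 1 - (i : ℕ)) =
        if ¬(e i = e a ∨ e i = e b) then ((-χ (e i)).toNat + (m * m - 1)).choose (m * m - 1) else 1
      have hcond : (2 ≤ m * m - 1 - (i : ℕ)) ↔ ¬(e i = e a ∨ e i = e b) := by
        rw [← hi, Fin.ext_iff, Fin.ext_iff]
        simp only [ha, hb, Fin.val_mk]
        have := i.2
        omega
      rw [hF]
      dsimp only
      rw [hval i]
      by_cases hc : 2 ≤ m * m - 1 - (i : ℕ)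
      · rw [if_pos hc, if_pos (hcond.mp hc)]
      · rw [if_neg hc, if_neg (fun h => hc (hcond.mpr h))]
    have h3 : ∏ i : Fin (m * m), F (m * m - 1 - (i : ℕ)) = ∏ i ∈ Finset.range (m * m), F i := by
      rw [Fin.prod_univ_eq_prod_range (fun i => F (m * m - 1 - i)) (m * m), Finset.prod_range_reflect]
    have h4 : ∏ i ∈ Finset.range (m * m), F i = ∏ i ∈ Finset.Ico 2 (m * m), G i := by
      rw [hF, ← Finset.prod_filter]
      congr 1
      ext i
      simp only [Finset.mem_filter, Finset.mem_range, Finset.mem_Ico]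
      omega
    rw [h1, h2, h3, h4]

/-- Stars and bars against the box: `C(k + n, n) ≤ (k + 1)^n` (each of the `n` factors
`(k + i)/i`, `1 ≤ i ≤ n`, is at most `k + 1`). [folklore] -/
theorem choose_add_le_succ_pow (k n : ℕ) : (k + n).choose n ≤ (k + 1) ^ n := by
  induction n with
  | zero => simp
  | succ n ih =>
    have hrec : (k + (n + 1)).choose (n + 1) * (n + 1) = (k + n).choose n * (k + n + 1) := by
      have h := Nat.add_one_mul_choose_eq (k + n) n
      -- (k + n + 1) * C(k + n, n) = C(k + n + 1, n + 1) * (n + 1)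
      rw [show k + (n + 1) = k + n + 1 by ring]
      linarith [h]
    have hle : (k + (n + 1)).choose (n + 1) * (n + 1) ≤ (k + 1) ^ (n + 1) * (n + 1) := by
      rw [hrec, pow_succ]
      calc (k + n).choose n * (k + n + 1)
          ≤ (k + 1) ^ n * (k + n + 1) := Nat.mul_le_mul_right _ ih
        _ ≤ (k + 1) ^ n * ((k + 1) * (n + 1)) := Nat.mul_le_mul_left _ (by nlinarith)
        _ = (k + 1) ^ n * (k + 1) * (n + 1) := by ring
    exact Nat.le_of_mul_le_mul_right hle (Nat.succ_pos n)

/-- **The binomial census is at most the box census**: for `m ≥ 1`,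
`C(λ₂ + m, m) · ∏_{i≥3} C(λ_i + m² - 1, m² - 1) ≤ (λ₂ + 1)^(m+1) · ∏_{i≥3} (λ_i + 1)^(m²)` — the bound of
`isotypicBinomialBound` sharpens that of `isotypicSliceBound` for every shape. [folklore] -/
theorem isotypicBinomialBound_le_isotypicSliceBound (m : ℕ) {d : ℕ} (lam : Nat.Partition d) :
    (lam.sortedParts.getD 1 0 + m).choose m *
        ∏ i ∈ Finset.Ico 2 (m * m), (lam.sortedParts.getD i 0 + (m * m - 1)).choose (m * m - 1) ≤
      (lam.sortedParts.getD 1 0 + 1) ^ (m + 1) *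
        ∏ i ∈ Finset.Ico 2 (m * m), (lam.sortedParts.getD i 0 + 1) ^ (m * m) := by
  refine Nat.mul_le_mul ((choose_add_le_succ_pow _ m).trans
    (Nat.pow_le_pow_right (Nat.succ_pos _) (Nat.le_succ m))) ?_
  refine Finset.prod_le_prod' fun i _ => ?_
  exact (choose_add_le_succ_pow _ (m * m - 1)).trans
    (Nat.pow_le_pow_right (Nat.succ_pos _) (Nat.sub_le _ _))

/-! ## The bound in the crux's currencies: valuative truncations and `K_m(λ*)` -/

/-- **Binomial bound for every valuative truncation.**  For `m ≥ 2`, every centre `U`, rank bound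
`r`, degree `δ` and partition `λ ⊢ mδ`, the crux's truncation
`T_U(λ) = Hom_{mδ} ⊓ I(L_U)^{δ(m-r)} ⊓ STAB(det_m) ⊓ HWSP(λ*)` (verbatim the `let T` of
`ValuativeGCT.ValuativeFlip`) has dimension at most `C(λ₂ + m, m) · ∏_{i ≥ 3} C(λ_i + m² - 1, m² - 1)`:
drop the ideal power, `STAB ≤ SAND` (`stub_stabInv_le_explicit`), and `isotypicBinomialBound`.
[this crux's det census; folklore] -/
theorem isotypic_truncT_finrank_le_choose (m : ℕ) (hm : 2 ≤ m) (U : Submodule ℂ (MatIdx m → ℂ))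
    (r δ : ℕ) (lam : Nat.Partition (m * δ)) :
    Module.finrank ℂ ↥(MvPolynomial.homogeneousSubmodule (MatIdx m × MatIdx m) ℂ (m * δ) ⊓
        ((MvPolynomial.vanishingIdeal ℂ {p : MatIdx m × MatIdx m → ℂ | ∀ j : MatIdx m, (fun i => p (j, i)) ∈ U}) ^
            (δ * (m - r))).restrictScalars ℂ ⊓
        (⨅ (M : Matrix (MatIdx m) (MatIdx m) ℂ) (_ : linSubst (MatIdx m) ℂ M (detFormLex ℂ m) = detFormLex ℂ m),
          LinearMap.ker ((MvPolynomial.aeval (R := ℂ) fun p : MatIdx m × MatIdx m =>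
              ∑ l : MatIdx m, M l p.2 • MvPolynomial.X (p.1, l)).toLinearMap -
            LinearMap.id (R := ℂ) (M := MvPolynomial (MatIdx m × MatIdx m) ℂ))) ⊓
        (⨅ (g : Matrix.GeneralLinearGroup (MatIdx m) ℂ) (_ : IsUpperTriangular g),
          LinearMap.ker ((MvPolynomial.aeval (R := ℂ) fun p : MatIdx m × MatIdx m =>
              ∑ l : MatIdx m, ((g⁻¹ : Matrix.GeneralLinearGroup (MatIdx m) ℂ) : Matrix (MatIdx m) (MatIdx m) ℂ) p.1 l •
                MvPolynomial.X (l, p.2)).toLinearMap -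
            weightChar ((Weight.dualOfPartition (m * m) lam).toMatIdx : Weight (MatIdx m)) g •
              LinearMap.id (R := ℂ) (M := MvPolynomial (MatIdx m × MatIdx m) ℂ)))) ≤
      (lam.sortedParts.getD 1 0 + m).choose m *
        ∏ i ∈ Finset.Ico 2 (m * m), (lam.sortedParts.getD i 0 + (m * m - 1)).choose (m * m - 1) := by
  haveI : Module.Finite ℂ ↥(MvPolynomial.homogeneousSubmodule (MatIdx m × MatIdx m) ℂ (m * δ)) :=
    Module.Finite.iff_fg.mpr (MvPolynomial.homogeneousSubmodule_fg (MatIdx m × MatIdx m) ℂ (m * δ))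
  haveI : Module.Finite ℂ ↥(MvPolynomial.homogeneousSubmodule (MatIdx m × MatIdx m) ℂ (m * δ) ⊓
        (⨅ (P : Matrix (Fin m) (Fin m) ℂ) (Q : Matrix (Fin m) (Fin m) ℂ) (_ : P.det = 1) (_ : Q.det = 1),
          LinearMap.ker ((MvPolynomial.aeval fun p : MatIdx m × MatIdx m =>
            ∑ l : MatIdx m, (P (ofLex p.2).1 (ofLex l).1 * Q (ofLex l).2 (ofLex p.2).2) •
              (MvPolynomial.X (p.1, l) : MvPolynomial (MatIdx m × MatIdx m) ℂ)).toLinearMap -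
            (LinearMap.id : MvPolynomial (MatIdx m × MatIdx m) ℂ →ₗ[ℂ] MvPolynomial (MatIdx m × MatIdx m) ℂ))) ⊓
        (⨅ (g : Matrix.GeneralLinearGroup (MatIdx m) ℂ) (_ : IsUpperTriangular g),
          LinearMap.ker ((MvPolynomial.aeval fun p : MatIdx m × MatIdx m =>
            ∑ l : MatIdx m, ((g⁻¹ : Matrix.GeneralLinearGroup (MatIdx m) ℂ) : Matrix (MatIdx m) (MatIdx m) ℂ) p.1 l •
              (MvPolynomial.X (l, p.2) : MvPolynomial (MatIdx m × MatIdx m) ℂ)).toLinearMap -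
            weightChar ((Weight.dualOfPartition (m * m) lam).toMatIdx : Weight (MatIdx m)) g •
              (LinearMap.id : MvPolynomial (MatIdx m × MatIdx m) ℂ →ₗ[ℂ] MvPolynomial (MatIdx m × MatIdx m) ℂ)))) :=
    Submodule.finiteDimensional_of_le (inf_le_left.trans inf_le_left)
  refine (Submodule.finrank_mono ?_).trans (isotypicBinomialBound m hm (m * δ) lam)
  exact le_inf (le_inf (inf_le_left.trans (inf_le_left.trans inf_le_left))
    ((inf_le_left.trans inf_le_right).trans ((stub_stabInv_le_explicit m).trans inf_le_left))) inf_le_right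

/-- **Binomial det-orbit-closure multiplicity bound.**  For `m ≥ 2`, every degree `δ` and every
`λ ⊢ mδ` with at most `m²` parts, the multiplicity of the dual weight `λ*` in the coordinate ring of
the orbit closure of `det_m` satisfies
`K_m(λ*) = mult_{λ*} ℂ[Δ(det_m)] ≤ C(λ₂ + m, m) · ∏_{i ≥ 3} C(λ_i + m² - 1, m² - 1)`
(`0`-indexed sorted parts `getD i`, `2 ≤ i < m²`): `K_m(λ*) ≤ dim T_⊥(λ)` by the route's valuative
bound (`ValuativeBound_proof`, BLMW 2011 Prop. 5.2.1 at `U = 0`) and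
`isotypic_truncT_finrank_le_choose`.  For a light tail `w = λ₃ + λ₄ + ⋯` this is
`≤ C(λ₂ + m, m) · (m²)^w` — polynomial in `m` for bounded `λ₂, w` — against the box bound's
`2^(m²)` per nonzero further part. [this crux's det census; BLMW 2011 §5.2] -/
theorem isotypic_detOrbitMultiplicity_le_choose : ∀ (m : ℕ) [NeZero m], 2 ≤ m → ∀ (δ : ℕ) (lam : Nat.Partition (m * δ)), lam.parts.card ≤ m * m → orbitMultiplicity ℂ (detFormLex ℂ m) m ((Weight.dualOfPartition (m * m) lam).toMatIdx : Weight (MatIdx m)) ≤ (lam.sortedParts.getD 1 0 + m).choose m * ∏ i ∈ Finset.Ico 2 (m * m), (lam.sortedParts.getD i 0 + (m * m - 1)).choose (m * m - 1) := by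
  intro m _ hm δ lam hlam
  have hU : ∀ u ∈ (⊥ : Submodule ℂ (MatIdx m → ℂ)), (Matrix.of fun a b : Fin m => u (toLex (a, b))).rank ≤ 0 := by
    intro u hu
    rw [Submodule.mem_bot] at hu
    subst hu
    have h0 : (Matrix.of fun a b : Fin m => (0 : MatIdx m → ℂ) (toLex (a, b))) = 0 := by
      ext a b
      simp
    rw [h0, Matrix.rank_zero]
  exact (Summit.ValiantsHypothesis.ValiantsHypothesis.Theorems.ValuativeBound.ValuativeBound_proof
    m ⊥ 0 hU δ lam hlam).trans (isotypic_truncT_finrank_le_choose m hm ⊥ 0 δ lam)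

/-- **Four-row reading, binomial form.**  For `m ≥ 2` and `λ ⊢ mδ` with at most four parts
`λ₁ ≥ λ₂ ≥ λ₃ ≥ λ₄ ≥ 0`,
`K_m(λ*) ≤ C(λ₂ + m, m) · C(λ₃ + m² - 1, m² - 1) · C(λ₄ + m² - 1, m² - 1)`.
[this crux's det census] -/
theorem isotypic_detOrbitMultiplicity_le_fourRow_choose (m : ℕ) [NeZero m] (hm : 2 ≤ m) (δ : ℕ)
    (lam : Nat.Partition (m * δ)) (hlam : lam.parts.card ≤ 4) :
    orbitMultiplicity ℂ (detFormLex ℂ m) m ((Weight.dualOfPartition (m * m) lam).toMatIdx : Weight (MatIdx m)) ≤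
      (lam.sortedParts.getD 1 0 + m).choose m *
        ((lam.sortedParts.getD 2 0 + (m * m - 1)).choose (m * m - 1) *
          (lam.sortedParts.getD 3 0 + (m * m - 1)).choose (m * m - 1)) := by
  have hmm : 4 ≤ m * m := by nlinarith
  refine (isotypic_detOrbitMultiplicity_le_choose m hm δ lam (hlam.trans hmm)).trans (le_of_eq ?_)
  congr 1
  have hlen : lam.sortedParts.length ≤ 4 := by
    rw [Nat.Partition.length_sortedParts]
    exact hlam
  have hsplit : Finset.Ico 2 (m * m) = {2, 3} ∪ Finset.Ico 4 (m * m) := by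
    ext i
    simp only [Finset.mem_Ico, Finset.mem_union, Finset.mem_insert, Finset.mem_singleton]
    omega
  have hdisj : Disjoint ({2, 3} : Finset ℕ) (Finset.Ico 4 (m * m)) := by
    rw [Finset.disjoint_left]
    intro i hi hi'
    simp only [Finset.mem_insert, Finset.mem_singleton] at hi
    rw [Finset.mem_Ico] at hi'
    omega
  have htail : ∏ i ∈ Finset.Ico 4 (m * m), (lam.sortedParts.getD i 0 + (m * m - 1)).choose (m * m - 1) = 1 := by
    refine Finset.prod_eq_one fun i hi => ?_
    rw [Finset.mem_Ico] at hi
    rw [List.getD_eq_default _ _ (by omega), zero_add, Nat.choose_self]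
  rw [hsplit, Finset.prod_union hdisj, htail, mul_one, Finset.prod_pair (by norm_num)]

/-! ## The crux reduced to a per-side statement with the binomial threshold -/

/-- **`ValuativeFlip` from binomial certificates.**  The crux `ValuativeGCT.ValuativeFlip` follows
(with the no-cut centre `U = ⊥`, `r = 0`) from a purely PER-SIDE statement with an explicit numeric
threshold: for every `c`, eventually in `n`, at every window position `n ≤ m ≤ 2^((log₂ n + c)^c)`
some shape `λ ⊢ mδ` (`≤ m²` parts) has padded-permanent multiplicity
`mult_{λ*} ℂ[Δ_m(X₀₀^{m-n} per_n)] > C(λ₂ + m, m) · ∏_{i ≥ 3} C(λ_i + m² - 1, m² - 1)`.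
Sharpens `valuativeFlip_of_isotypicCertificates` (smaller threshold, same conclusion).
[this crux; reduction] -/
theorem valuativeFlip_of_binomialCertificates
    (h : ∀ c : ℕ, ∃ n₀ : ℕ, ∀ n ≥ n₀, ∀ (m : ℕ) [NeZero m], n ≤ m → m ≤ 2 ^ ((Nat.log 2 n + c) ^ c) →
      ∃ (δ : ℕ) (lam : Nat.Partition (m * δ)), lam.parts.card ≤ m * m ∧
        (lam.sortedParts.getD 1 0 + m).choose m *
            ∏ i ∈ Finset.Ico 2 (m * m), (lam.sortedParts.getD i 0 + (m * m - 1)).choose (m * m - 1) <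
          orbitMultiplicity ℂ (paddedPerFormLex ℂ n m) m
            ((Weight.dualOfPartition (m * m) lam).toMatIdx : Weight (MatIdx m))) :
    Summit.ValiantsHypothesis.ValiantsHypothesis.Theses.ValuativeGCT.ValuativeFlip := by
  intro c
  obtain ⟨n₀, hn₀⟩ := h c
  refine ⟨max n₀ 2, fun n hn m _ hnm hm => ?_⟩
  have hm2 : 2 ≤ m := le_trans (le_of_max_le_right hn) hnm
  obtain ⟨δ, lam, hcard, hlt⟩ := hn₀ n (le_of_max_le_left hn) m hnm hm
  refine ⟨⊥, 0, δ, lam, ?_, hcard, ?_⟩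
  · intro u hu
    rw [Submodule.mem_bot] at hu
    subst hu
    have h0 : (Matrix.of fun a b : Fin m => (0 : MatIdx m → ℂ) (toLex (a, b))) = 0 := by
      ext a b
      simp
    rw [h0, Matrix.rank_zero]
  · intro χ T
    exact lt_of_le_of_lt (isotypic_truncT_finrank_le_choose m hm2 ⊥ 0 δ lam) hlt

/-- **Mulmuley–Sohoni obstruction from a binomial certificate** (one position).  For `m ≥ 2`, a
shape `λ ⊢ mδ` (`≤ m²` parts) whose padded-permanent multiplicity exceeds the binomial det census,
`mult_{λ*} ℂ[Δ_m(X₀₀^{m-n} per_n)] > C(λ₂ + m, m) · ∏_{i ≥ 3} C(λ_i + m² - 1, m² - 1)`, is a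
multiplicity obstruction `K_m(λ*) < mult_{λ*} ℂ[Δ_m(X₀₀^{m-n} per_n)]` (hence
`X₀₀^{m-n} per_n ∉ Δ(det_m)` by the landed `GctMultPrinciple`). [this crux; Mulmuley–Sohoni 2001 §4] -/
theorem detOrbitMultiplicity_lt_of_binomialCertificate (n m : ℕ) [NeZero m] (hm : 2 ≤ m) (δ : ℕ)
    (lam : Nat.Partition (m * δ)) (hcard : lam.parts.card ≤ m * m)
    (hlt : (lam.sortedParts.getD 1 0 + m).choose m *
        ∏ i ∈ Finset.Ico 2 (m * m), (lam.sortedParts.getD i 0 + (m * m - 1)).choose (m * m - 1) <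
      orbitMultiplicity ℂ (paddedPerFormLex ℂ n m) m
        ((Weight.dualOfPartition (m * m) lam).toMatIdx : Weight (MatIdx m))) :
    orbitMultiplicity ℂ (detFormLex ℂ m) m ((Weight.dualOfPartition (m * m) lam).toMatIdx : Weight (MatIdx m)) <
      orbitMultiplicity ℂ (paddedPerFormLex ℂ n m) m
        ((Weight.dualOfPartition (m * m) lam).toMatIdx : Weight (MatIdx m)) :=
  lt_of_le_of_lt (isotypic_detOrbitMultiplicity_le_choose m hm δ lam hcard) hlt

end

end Summit.ValiantsHypothesis.ValiantsHypothesis.Theorems.ValuativeFlip
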